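import Mathlib
import HarnessLib
import Summits.HubbardSuperconductivity.HubbardSuperconductivity.Theorems.KLProgrammeKLRegimeEngineTowerChernoff

/-!
# Route `KLProgramme` — crux K3 ENGINE (stmt-HubbardSuperconductivity-20437 `KLRegimeEngineV17F2`), stub (b): the blocked-tower bookkeeping,
# part 11 — the LIPSCHITZ (two-volume / two-cutoff DIFFERENCE) form of the tower: relative defects accumulate ADDITIVELY over blocks
# (E1 lead r2d-p2 g7; plan g19's question (6) «TOWER-LIPSCHITZ (L)» = (R59)/(R59i) located risk «(e)-C-RATE», supplier (α) «(b)-TWOVOL»)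

Rows C1/C2 of stub (e) (`TwoLegVolumeRateF … n`, a `Q.CL β n / L` rate for the two-volume / two-cutoff reading differences) need, at deep scales
`n ≳ ln(1/U)`, the (b)-tower run on the DIFFERENCE of the two volumes' data in (b)'s own scale-covariant currency (k3c4-p1 VL-ROUTE-A-RADIUS §2,
k3c5-p2 KL l.3448: the generic single-scale two-volume STEP loses radius per scale and survives only `O(ln 1/U)` scales).  This is the
dimensionless half of that statement — the sibling of parts 5a/5b (`towerStep_le_of_chernoff`, `towerBorn_le_law₄`) for DIFFERENCE data:
two towers whose measured block-step inputs have a COMMON MAJORANT `μ̄ k` with the four-piece profile of part 5a (the one-volume towers are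
closed: OUTPUT of `towerBorn_le_law₄` + T1/T1₃ for each volume); nonnegative difference data `db k p` (born, after the consumer's transfer map,
units `2^{(3p−5)J_k}`) and `dμ k m` (measured); the LIPSCHITZ STEP HYPOTHESIS — every order-`n` term is MULTILINEAR in its `n` inputs, so by
telescoping (`T(V,…,V) − T(V′,…,V′) = Σ_a T(V′,…,V−V′,…,V)`) its difference is bounded by the graded sum with ONE slot carrying the difference
profile and the others the majorant (`towerSLip`, all positions of the odd slot summed), the first order is LINEAR (`towerFO D σ (dμ k) p`), the
tails are `Ct` tails of the majorant, and the step's own volume / covariance dependence is a SOURCE `src k p` (the only place `1/L` enters);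
relative sizes: UV `db 0 p ≤ R 0·Aλ^{p−1}Q^p`, imports `dμ k 1 ≤ R k·ι₁λ`, `dμ k 2 ≤ R k·ι₂λ` (the two-leg slot's and the value line's own
two-volume rows), sources `src k p ≤ s k·Aλ^{p−1}Q^p`, a budget `R k + s k ≤ R (k+1)`.

* `towerSLip`, `towerSLip_le_chernoff` — the mixed graded sum and its Chernoff bound `(w^{p−1})⁻¹ · n · Gν · G^{n−1}`;
* `sum_Icc_mul_pow_sub_one_le` — `Σ_{n∈[2,N]} n y^{n−1} ≤ (2y − y²)/(1 − y)²` (`0 ≤ y < 1`);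
* **`towerLipStep_le_of_chernoff`** (T2-Lip) — `db ≤ Fν + e·ψ^p·(w^{p−1})⁻¹·Gν·(2y − y²)/(1 − y)² + src`, `y = ΦG`;
* **`towerBornDiff_le_law₄`** (T3-Lip₄) — the induction over blocks with part 5b's smallness/blocking conditions and the LIPSCHITZ closing
  inequality at `p = 3` (`y/(1−y) ↦ (2y−y²)/(1−y)²`: the block map is a CONTRACTION in law units on the irrelevant born data):
  **`∀ k ≤ K, ∀ 3 ≤ p ≤ D, db k p ≤ R k · Aλ^{p−1}Q^p`** — the relative defect budget is ADDITIVE, `R K = R 0 + Σ_{k<K} s k` suffices, uniformly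
  in `D`, `K`, `N`; a per-block source `c/L` over `≈ n_β/d` blocks is a `1/L` RATE with a constant linear in the number of scales (`Q.CL β n`
  allows `4^n`).
NOT here (other lanes): the two-volume transfer map / glued profiles (k3c4-p1 p556216, p556576), the covariance finite-size source, the read-out
of rows C1/C2 (k3c5-p2's dual doors), and the Grassmann-level supplier «G1-Lip» (G1 p532203 with SLOT-WISE input norms = the telescoped
multilinear bound; same proof as G1).  Pure real analysis; nothing about the model is asserted.  References: Benfatto–Giuliani–Mastropietro 2006
§2.8; Gawȩdzki–Kupiainen 1985 §3 (contraction of the irrelevant directions).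
-/

noncomputable section

namespace Summit.HubbardSuperconductivity.HubbardSuperconductivity.Theorems.EngineV8

set_option linter.dupNamespace false -- summit = problem name (single-conjunct summit), D-0017

open Real Finset

/-! ## §0 The mixed graded sum (one slot carries the difference profile) -/

/-- **The mixed graded product sum of order `n` in output degree `2p`** (Lipschitz form of `towerS`): over the same constrained
half-degree assignments `δ ∈ [1,D]^n`, `p + n − 1 ≤ Σ_a δ_a`, the sum over the position `a` of the ONE slot that carries the difference
profile `ν`, the other `n − 1` slots carrying the common majorant `μ`:
`Σ_δ Σ_a τ^{δ_a} ν(δ_a) · Π_{a' ≠ a} τ^{δ_{a'}} μ(δ_{a'})` — the telescoped multilinear bound of `T(μ,…,μ) − T(μ′,…,μ′)`. -/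
def towerSLip (D : ℕ) (τ : ℝ) (ν μ : ℕ → ℝ) (n p : ℕ) : ℝ :=
  ∑ δ ∈ (Fintype.piFinset fun _ : Fin n => Icc 1 D) with p + n - 1 ≤ ∑ a, δ a,
    ∑ a, τ ^ (δ a) * ν (δ a) * ∏ a' ∈ univ.erase a, τ ^ (δ a') * μ (δ a')

/-- `towerSLip ≥ 0` for nonnegative data. -/
theorem towerSLip_nonneg {D : ℕ} {τ : ℝ} {ν μ : ℕ → ℝ} (hτ : 0 ≤ τ) (hν : ∀ m, 0 ≤ ν m) (hμ : ∀ m, 0 ≤ μ m) (n p : ℕ) :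
    0 ≤ towerSLip D τ ν μ n p :=
  sum_nonneg fun δ _ => sum_nonneg fun a _ =>
    mul_nonneg (by have := hν (δ a); positivity) (prod_nonneg fun a' _ => by have := hμ (δ a'); positivity)

/-- The unconstrained mixed product sum factorises: for a fixed odd slot `a`,
`Σ_{δ ∈ [1,D]^n} F(δ_a) · Π_{a' ≠ a} G(δ_{a'}) = (Σ_{x∈[1,D]} F x) · (Σ_{x∈[1,D]} G x)^{n−1}`. -/
theorem sum_piFinset_mul_prod_erase_eq {D n : ℕ} (F G : ℕ → ℝ) (a : Fin n) :
    ∑ δ ∈ Fintype.piFinset (fun _ : Fin n => Icc 1 D), F (δ a) * ∏ a' ∈ univ.erase a, G (δ a') =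
      (∑ x ∈ Icc 1 D, F x) * (∑ x ∈ Icc 1 D, G x) ^ (n - 1) := by
  classical
  -- write the summand as a product over ALL slots of a slot-dependent factor
  set h : Fin n → ℕ → ℝ := fun a' x => if a' = a then F x else G x with hh
  have hsummand : ∀ δ : Fin n → ℕ, F (δ a) * ∏ a' ∈ univ.erase a, G (δ a') = ∏ a', h a' (δ a') := by
    intro δ
    rw [← mul_prod_erase univ (fun a' => h a' (δ a')) (mem_univ a)]
    congr 1
    · simp [hh]
    · exact prod_congr rfl fun a' ha' => by rw [hh]; dsimp only; rw [if_neg (ne_of_mem_erase ha')]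
  rw [sum_congr rfl fun δ _ => hsummand δ, ← prod_univ_sum (fun _ : Fin n => Icc 1 D) h,
    ← mul_prod_erase univ (fun a' => ∑ x ∈ Icc 1 D, h a' x) (mem_univ a)]
  congr 1
  · simp [hh]
  · rw [prod_congr rfl fun a' ha' => show ∑ x ∈ Icc 1 D, h a' x = ∑ x ∈ Icc 1 D, G x from
        sum_congr rfl fun x _ => by rw [hh]; dsimp only; rw [if_neg (ne_of_mem_erase ha')],
      prod_const, card_erase_of_mem (mem_univ a), card_univ, Fintype.card_fin]

/-- **Chernoff form of the mixed graded sum**: for `w ≥ 1`, `0 ≤ τ, ν, μ`,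
`towerSLip D τ ν μ n p ≤ (w^{p−1})⁻¹ · n · Gν · G^{n−1}`, `Gν = Σ_{δ∈[1,D]} τ^δ ν(δ) w^{δ−1}`, `G = Σ_{δ∈[1,D]} τ^δ μ(δ) w^{δ−1}` — as
`towerS_le_chernoff`: the constraint gives `1 ≤ w^{Σ(δ_a−1)}/w^{p−1}`, and for each position of the odd slot the product sum factorises. -/
theorem towerSLip_le_chernoff {D : ℕ} {τ w : ℝ} {ν μ : ℕ → ℝ} (hτ : 0 ≤ τ) (hν0 : ∀ m, 0 ≤ ν m) (hμ0 : ∀ m, 0 ≤ μ m) (hw : 1 ≤ w)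
    (n p : ℕ) :
    towerSLip D τ ν μ n p ≤ (w ^ (p - 1))⁻¹ * (n * ((∑ δ ∈ Icc 1 D, τ ^ δ * ν δ * w ^ (δ - 1)) *
      (∑ δ ∈ Icc 1 D, τ ^ δ * μ δ * w ^ (δ - 1)) ^ (n - 1))) := by
  classical
  have hw0 : 0 < w := one_pos.trans_le hw
  set Fw : ℕ → ℝ := fun x => τ ^ x * ν x * w ^ (x - 1) with hFw
  set Gw : ℕ → ℝ := fun x => τ ^ x * μ x * w ^ (x - 1) with hGw
  have hFw0 : ∀ x, 0 ≤ Fw x := fun x => by have := hν0 x; positivity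
  have hGw0 : ∀ x, 0 ≤ Gw x := fun x => by have := hμ0 x; positivity
  -- termwise: on the constraint, inserting the weights costs at most `(w^{p-1})⁻¹`
  have hterm : ∀ δ ∈ (Fintype.piFinset fun _ : Fin n => Icc 1 D).filter (fun δ => p + n - 1 ≤ ∑ a, δ a),
      ∑ a, τ ^ (δ a) * ν (δ a) * ∏ a' ∈ univ.erase a, τ ^ (δ a') * μ (δ a') ≤
        (w ^ (p - 1))⁻¹ * ∑ a, Fw (δ a) * ∏ a' ∈ univ.erase a, Gw (δ a') := by
    intro δ hδ
    rw [mem_filter, Fintype.mem_piFinset] at hδ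
    obtain ⟨hδD, hc⟩ := hδ
    have hδ1 : ∀ a, 1 ≤ δ a := fun a => (mem_Icc.1 (hδD a)).1
    have hTS : ∑ a, (δ a - 1) + n = ∑ a, δ a := by
      have : ∑ a : Fin n, (δ a - 1) + ∑ _a : Fin n, 1 = ∑ a, δ a := by
        rw [← sum_add_distrib]; exact sum_congr rfl fun a _ => Nat.sub_add_cancel (hδ1 a)
      rwa [sum_const, card_univ, Fintype.card_fin, smul_eq_mul, mul_one] at this
    have hT : p - 1 ≤ ∑ a, (δ a - 1) := by omega
    have hge : 1 ≤ w ^ (∑ a, (δ a - 1)) * (w ^ (p - 1))⁻¹ := by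
      rw [← div_eq_mul_inv, one_le_div (pow_pos hw0 _)]
      exact pow_le_pow_right₀ hw hT
    rw [mul_sum]
    refine sum_le_sum fun a _ => ?_
    -- the `a`-term with weights = the `a`-term without weights × `w^{Σ(δ-1)}`
    have hsplit : Fw (δ a) * ∏ a' ∈ univ.erase a, Gw (δ a') =
        (τ ^ (δ a) * ν (δ a) * ∏ a' ∈ univ.erase a, τ ^ (δ a') * μ (δ a')) * w ^ (∑ a', (δ a' - 1)) := by
      have hwprod : w ^ (∑ a', (δ a' - 1)) = w ^ (δ a - 1) * ∏ a' ∈ univ.erase a, w ^ (δ a' - 1) := by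
        rw [← prod_pow_eq_pow_sum, ← mul_prod_erase univ (fun a' => w ^ (δ a' - 1)) (mem_univ a)]
      rw [hwprod, hFw, hGw]; dsimp only; rw [prod_mul_distrib]; ring
    have hP0 : 0 ≤ τ ^ (δ a) * ν (δ a) * ∏ a' ∈ univ.erase a, τ ^ (δ a') * μ (δ a') :=
      mul_nonneg (by have := hν0 (δ a); positivity) (prod_nonneg fun a' _ => by have := hμ0 (δ a'); positivity)
    rw [hsplit]
    calc τ ^ (δ a) * ν (δ a) * ∏ a' ∈ univ.erase a, τ ^ (δ a') * μ (δ a')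
        ≤ (τ ^ (δ a) * ν (δ a) * ∏ a' ∈ univ.erase a, τ ^ (δ a') * μ (δ a')) * (w ^ (∑ a', (δ a' - 1)) * (w ^ (p - 1))⁻¹) :=
          le_mul_of_one_le_right hP0 hge
      _ = _ := by ring
  unfold towerSLip
  refine (sum_le_sum hterm).trans ?_
  -- drop the constraint, swap the sums, factorise
  refine (sum_le_sum_of_subset_of_nonneg (filter_subset _ _) fun δ _ _ => ?_).trans ?_
  · exact mul_nonneg (by positivity) (sum_nonneg fun a _ => mul_nonneg (hFw0 _) (prod_nonneg fun a' _ => hGw0 _))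
  · rw [← mul_sum, sum_comm]
    refine mul_le_mul_of_nonneg_left (le_of_eq ?_) (by positivity)
    rw [sum_congr rfl fun a _ => sum_piFinset_mul_prod_erase_eq Fw Gw a, sum_const, card_univ, Fintype.card_fin, nsmul_eq_mul]

/-! ## §1 The derivative of the geometric series -/

/-- `Σ_{n ∈ [2, N]} n·y^{n−1} ≤ (2y − y²)/(1 − y)²` for `0 ≤ y < 1` (`= Σ_{n ≥ 2} n y^{n−1} = (1−y)^{−2} − 1`). -/
theorem sum_Icc_mul_pow_sub_one_le {y : ℝ} (hy0 : 0 ≤ y) (hy1 : y < 1) (N : ℕ) :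
    ∑ n ∈ Icc 2 N, (n : ℝ) * y ^ (n - 1) ≤ (2 * y - y ^ 2) / (1 - y) ^ 2 := by
  have hy1' : 0 < 1 - y := sub_pos.2 hy1
  have hnorm : ‖y‖ < 1 := by rw [Real.norm_eq_abs, abs_of_nonneg hy0]; exact hy1
  have h1 : HasSum (fun j : ℕ => (j : ℝ) * y ^ j) (y / (1 - y) ^ 2) := hasSum_coe_mul_geometric_of_norm_lt_one hnorm
  have h2 : HasSum (fun j : ℕ => y ^ j) (1 - y)⁻¹ := hasSum_geometric_of_lt_one hy0 hy1
  have h3 : HasSum (fun j : ℕ => ((j : ℝ) + 1) * y ^ j) (y / (1 - y) ^ 2 + (1 - y)⁻¹) := by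
    convert h1.add h2 using 1; ext j; ring
  have hval : y / (1 - y) ^ 2 + (1 - y)⁻¹ = 1 / (1 - y) ^ 2 := by field_simp; ring
  rw [hval] at h3
  -- reindex `n = j + 1`, `j ∈ [1, N-1]`, and compare with the full series minus its `j = 0` term
  have hre : ∑ n ∈ Icc 2 N, (n : ℝ) * y ^ (n - 1) = ∑ j ∈ Icc 1 (N - 1), ((j : ℝ) + 1) * y ^ j := by
    rcases Nat.lt_or_ge N 2 with hN | hN
    · rw [Icc_eq_empty (by omega), Icc_eq_empty (by omega), sum_empty, sum_empty]
    · have hI : Icc 2 N = (Icc 1 (N - 1)).map (addRightEmbedding 1) := by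
        rw [map_add_right_Icc]; congr 1; omega
      rw [hI, sum_map]
      refine sum_congr rfl fun j _ => ?_
      simp only [addRightEmbedding_apply, Nat.add_sub_cancel, Nat.cast_add, Nat.cast_one]
  rw [hre]
  have hsub : ∑ j ∈ Icc 1 (N - 1), ((j : ℝ) + 1) * y ^ j ≤ ∑ j ∈ insert 0 (Icc 1 (N - 1)), ((j : ℝ) + 1) * y ^ j - 1 := by
    rw [sum_insert (by simp), Nat.cast_zero, zero_add, pow_zero, one_mul]
    linarith
  refine hsub.trans ?_
  have hle : ∑ j ∈ insert 0 (Icc 1 (N - 1)), ((j : ℝ) + 1) * y ^ j ≤ 1 / (1 - y) ^ 2 :=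
    h3.summable.sum_le_tsum _ (fun j _ => by positivity) |>.trans (le_of_eq h3.tsum_eq)
  calc _ ≤ 1 / (1 - y) ^ 2 - 1 := by linarith
    _ = (2 * y - y ^ 2) / (1 - y) ^ 2 := by field_simp; ring

/-! ## §2 (T2-Lip) The Lipschitz block step from Chernoff data -/

/-- **(T2-Lip) The Lipschitz block step in closed form from Chernoff data.**  Difference profile `0 ≤ ν`, common majorant `0 ≤ μ` of the two
volumes' measured inputs, `w ≥ 1`, bounds `towerFO D σ ν p ≤ Fν`, `Σ_{δ∈[1,D]} τ^δ ν(δ) w^{δ−1} ≤ Gν`, `Σ_{δ∈[1,D]} τ^δ μ(δ) w^{δ−1} ≤ G`,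
`towerV D τ μ ≤ V̄`, `Φ·G < 1`, `Φ·V̄ < 1`; the suppliers' LIPSCHITZ step hypothesis for the born DIFFERENCE `db` in degree `2p` (∀ N ≥ 2, under
the guard `ΦV < 1`): linear first order in `ν`, telescoped graded orders `2 … N` (`towerSLip`), `Ct` tails of the majorant, a SOURCE `src`.
Then `db ≤ Fν + e·ψ^p·(w^{p−1})⁻¹·Gν·(2y − y²)/(1 − y)² + src`, `y = ΦG` (`Σ_n n y^{n−1}`: the derivative of T2-gen's `y/(1−y)`). -/
theorem towerLipStep_le_of_chernoff {D : ℕ} {ν μ : ℕ → ℝ} {db σ Φ ψ τ w Fν Gν G Vb Ct src : ℝ}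
    (hΦ : 0 ≤ Φ) (hψ : 0 ≤ ψ) (hτ : 0 ≤ τ) (hν0 : ∀ m, 0 ≤ ν m) (hμ0 : ∀ m, 0 ≤ μ m) (hw : 1 ≤ w) (hCt : 0 ≤ Ct)
    {p : ℕ} (hFp : towerFO D σ ν p ≤ Fν)
    (hGν : ∑ δ ∈ Icc 1 D, τ ^ δ * ν δ * w ^ (δ - 1) ≤ Gν) (hG : ∑ δ ∈ Icc 1 D, τ ^ δ * μ δ * w ^ (δ - 1) ≤ G)
    (hVb : towerV D τ μ ≤ Vb) (hyG : Φ * G < 1) (hθ : Φ * Vb < 1)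
    (hstep : ∀ N : ℕ, 2 ≤ N → Φ * towerV D τ μ < 1 →
      db ≤ towerFO D σ ν p + ∑ n ∈ Icc 2 N, exp 1 * Φ ^ (n - 1) * ψ ^ p * towerSLip D τ ν μ n p +
        Ct * (ψ ^ p * exp 1 * towerV D τ μ * (Φ * towerV D τ μ) ^ N / (1 - Φ * towerV D τ μ)) + src) :
    db ≤ Fν + exp 1 * ψ ^ p * (w ^ (p - 1))⁻¹ * Gν * ((2 * (Φ * G) - (Φ * G) ^ 2) / (1 - Φ * G) ^ 2) + src := by
  set V := towerV D τ μ with hVdef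
  have hV0 : 0 ≤ V := towerV_nonneg hτ hμ0
  have hθ0 : 0 ≤ Φ * V := mul_nonneg hΦ hV0
  have hθle : Φ * V ≤ Φ * Vb := mul_le_mul_of_nonneg_left hVb hΦ
  have hθ1 : Φ * V < 1 := hθle.trans_lt hθ
  have hθb0 : 0 ≤ Φ * Vb := hθ0.trans hθle
  have hVb0 : 0 ≤ Vb := hV0.trans hVb
  have hw0 : 0 < w := one_pos.trans_le hw
  have hGν0 : 0 ≤ Gν := (sum_nonneg fun δ _ => by have := hν0 δ; positivity).trans hGν
  have hG0' : 0 ≤ ∑ δ ∈ Icc 1 D, τ ^ δ * μ δ * w ^ (δ - 1) := sum_nonneg fun δ _ => by have := hμ0 δ; positivity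
  have hG0 : 0 ≤ G := hG0'.trans hG
  have hy0 : 0 ≤ Φ * G := mul_nonneg hΦ hG0
  set M := exp 1 * ψ ^ p * (w ^ (p - 1))⁻¹ * Gν with hM
  have hM0 : 0 ≤ M := by positivity
  set Z := (2 * (Φ * G) - (Φ * G) ^ 2) / (1 - Φ * G) ^ 2 with hZ
  set T : ℕ → ℝ := fun N => Ct * (ψ ^ p * exp 1 * Vb * (Φ * Vb) ^ N / (1 - Φ * Vb)) with hT
  have hGr : ∀ N, ∑ n ∈ Icc 2 N, exp 1 * Φ ^ (n - 1) * ψ ^ p * towerSLip D τ ν μ n p ≤ M * Z := by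
    intro N
    have hterm : ∀ n ∈ Icc 2 N, exp 1 * Φ ^ (n - 1) * ψ ^ p * towerSLip D τ ν μ n p ≤ M * ((n : ℝ) * (Φ * G) ^ (n - 1)) := by
      intro n hn
      have hS := towerSLip_le_chernoff (D := D) hτ hν0 hμ0 hw n p
      have hpow : (∑ δ ∈ Icc 1 D, τ ^ δ * μ δ * w ^ (δ - 1)) ^ (n - 1) ≤ G ^ (n - 1) := pow_le_pow_left₀ hG0' hG _
      have hS' : towerSLip D τ ν μ n p ≤ (w ^ (p - 1))⁻¹ * (n * (Gν * G ^ (n - 1))) := by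
        refine hS.trans (mul_le_mul_of_nonneg_left ?_ (by positivity))
        gcongr
      calc exp 1 * Φ ^ (n - 1) * ψ ^ p * towerSLip D τ ν μ n p
          ≤ exp 1 * Φ ^ (n - 1) * ψ ^ p * ((w ^ (p - 1))⁻¹ * (n * (Gν * G ^ (n - 1)))) := by
            have := towerSLip_nonneg hτ hν0 hμ0 n p (D := D)
            gcongr
        _ = M * ((n : ℝ) * (Φ * G) ^ (n - 1)) := by rw [hM, mul_pow]; ring
    refine (sum_le_sum hterm).trans ?_
    rw [← mul_sum]
    exact mul_le_mul_of_nonneg_left (sum_Icc_mul_pow_sub_one_le hy0 hyG N) hM0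
  have hTail : ∀ N, Ct * (ψ ^ p * exp 1 * V * (Φ * V) ^ N / (1 - Φ * V)) ≤ T N := by
    intro N
    have h1 : 0 < 1 - Φ * Vb := sub_pos.2 hθ
    have h2 : 1 - Φ * Vb ≤ 1 - Φ * V := by linarith
    rw [hT]; dsimp only; refine mul_le_mul_of_nonneg_left ?_ hCt
    rw [div_eq_mul_inv, div_eq_mul_inv]
    have hinv : (1 - Φ * V)⁻¹ ≤ (1 - Φ * Vb)⁻¹ := inv_anti₀ h1 h2
    have hpowN : (Φ * V) ^ N ≤ (Φ * Vb) ^ N := pow_le_pow_left₀ hθ0 hθle N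
    have : 0 ≤ (1 - Φ * V)⁻¹ := inv_nonneg.2 (sub_nonneg.2 hθ1.le)
    gcongr
  have hbN : ∀ N, 2 ≤ N → db ≤ Fν + M * Z + T N + src := fun N hN =>
    (hstep N hN hθ1).trans (by linarith [hFp, hGr N, hTail N])
  have hTto : Filter.Tendsto T Filter.atTop (nhds 0) := by
    have h := ((tendsto_pow_atTop_nhds_zero_of_lt_one hθb0 hθ).mul_const ((1 - Φ * Vb)⁻¹)).const_mul (Ct * (ψ ^ p * exp 1 * Vb))
    rw [zero_mul, mul_zero] at h
    refine h.congr' (Filter.Eventually.of_forall fun N => ?_)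
    rw [hT]; dsimp only; rw [div_eq_mul_inv]; ring
  have hlim : Filter.Tendsto (fun N => Fν + M * Z + T N + src) Filter.atTop (nhds (Fν + M * Z + 0 + src)) :=
    ((hTto.const_add (Fν + M * Z)).add_const src)
  have := ge_of_tendsto hlim (Filter.eventually_atTop.2 ⟨2, fun N hN => hbN N hN⟩)
  rwa [add_zero, hM] at this

/-! ## §3 (T3-Lip₄) The induction over blocks: relative defects accumulate additively -/

/-- A budget with `R k + s k ≤ R (k+1)` and `0 ≤ s` is nondecreasing. -/
theorem budget_mono {R s : ℕ → ℝ} (hs : ∀ k, 0 ≤ s k) (hR : ∀ k, R k + s k ≤ R (k + 1)) {k' k : ℕ} (h : k' ≤ k) :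
    R k' ≤ R k := by
  induction k with
  | zero => rw [Nat.le_zero.1 h]
  | succ k ih =>
    rcases Nat.lt_succ_iff_lt_or_eq.1 (Nat.lt_succ_of_le h) with hlt | rfl
    · exact (ih (Nat.lt_succ_iff.1 hlt)).trans (by linarith [hs k, hR k])
    · exact le_rfl

/-- **(T3-Lip₄) The Lipschitz (two-volume difference) tower closes; the relative defect budget is ADDITIVE over blocks.**
Setting of `towerBorn_le_law₄` (part 5b) for TWO volumes whose measured block-step inputs have a common majorant `μ̄ k` with the four-piece
profile (the one-volume towers are closed), and nonnegative DIFFERENCE data `db k p` (born), `dμ k m` (measured): (D0) UV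
`db 0 p ≤ R 0·Aλ^{p−1}Q^p`; (Dμ) re-measurement is linear — part 5b's rows verbatim on `db` (ratio `g` in degrees `2m ≥ 8`, `g₃` at six legs);
(Dι) the imported degrees' own two-volume rows `dμ k 1 ≤ R k·ι₁λ`, `dμ k 2 ≤ R k·ι₂λ`; (Dstep) the Lipschitz step hypothesis of
`towerLipStep_le_of_chernoff` at every `k < K`, `3 ≤ p ≤ D`, source `src k p ≤ s k·Aλ^{p−1}Q^p`, `0 ≤ s`, budget `0 ≤ R 0`, `R k + s k ≤ R (k+1)`;
(Hnum) part 5b's smallness and BLOCKING conditions and the LIPSCHITZ closing inequality at `p = 3`,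
`A'(4Q')³x₁/(1−x₁) + eψ(2τψQ')²·τY·(2y − y²)/(1 − y)² ≤ AQ³`, `y = ΦτY` (a contraction on the irrelevant born data in law units).
Conclusion: **`∀ k ≤ K, ∀ 3 ≤ p ≤ D, db k p ≤ R k · Aλ^{p−1}Q^p`** — `R K = R 0 + Σ_{k<K} s k` suffices; a per-block source `c/L` over `≈ n_β/d`
blocks gives the two-volume defect a `1/L` rate with a constant linear in the number of scales, uniformly in `D`, `K`, `N`. -/
theorem towerBornDiff_le_law₄ {D K : ℕ} {db dμ μb src : ℕ → ℕ → ℝ} {R s : ℕ → ℝ}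
    {A lam Q g g₃ c₁ c₂ σ Φ ψ τ A' Q' ι₁ ι₂ ι₃ Ct : ℝ}
    (hA : 0 ≤ A) (hlam : 0 < lam) (hQ : 0 ≤ Q) (hg0 : 0 < g) (hg1 : g < 1) (hg₃0 : 0 ≤ g₃) (hg₃1 : g₃ < 1) (hc₁ : 0 ≤ c₁) (hc₂ : 0 ≤ c₂)
    (hσ : 0 ≤ σ) (hΦ : 0 ≤ Φ) (hψ : 0 ≤ ψ) (hτ : 0 < τ) (hQ'0 : 0 < Q') (hCt : 0 ≤ Ct)
    (hA'ge : c₁ * A / ((1 - g) * g ^ 2) ≤ A') (hQ'ge : c₂ * g * Q ≤ Q') (hι₃ge : c₁ * c₂ ^ 3 * A * Q ^ 3 * (g₃ / (1 - g₃)) ≤ ι₃)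
    (hdb0 : ∀ k m, 0 ≤ db k m) (hdμ0 : ∀ k m, 0 ≤ dμ k m) (hμb0 : ∀ k m, 0 ≤ μb k m)
    (hs0 : ∀ k, 0 ≤ s k) (hR0 : 0 ≤ R 0) (hR : ∀ k, R k + s k ≤ R (k + 1))
    -- the common majorant's four-piece profile (the one-volume towers are closed)
    (hῑ₁ : ∀ k < K, μb k 1 ≤ ι₁ * lam) (hῑ₂ : ∀ k < K, μb k 2 ≤ ι₂ * lam) (hῑ₃ : ∀ k < K, μb k 3 ≤ ι₃ * lam ^ 2)
    (hprofb : ∀ k < K, ∀ m, 4 ≤ m → m ≤ D → μb k m ≤ A' * lam ^ (m - 1) * Q' ^ m)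
    -- the difference data
    (hd0 : ∀ p, 3 ≤ p → p ≤ D → db 0 p ≤ R 0 * (A * lam ^ (p - 1) * Q ^ p))
    (hdμ : ∀ k < K, ∀ m, 4 ≤ m → m ≤ D →
      dμ k m ≤ ∑ k' ∈ range (k + 1), c₁ * c₂ ^ m * g ^ ((m - 2) * (k + 1 - k')) * db k' m)
    (hdμ3 : ∀ k < K, 3 ≤ D → dμ k 3 ≤ ∑ k' ∈ range (k + 1), c₁ * c₂ ^ 3 * g₃ ^ (k + 1 - k') * db k' 3)
    (hdι₁ : ∀ k < K, dμ k 1 ≤ R k * ι₁ * lam) (hdι₂ : ∀ k < K, dμ k 2 ≤ R k * ι₂ * lam)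
    (hsrc : ∀ k < K, ∀ p, 3 ≤ p → p ≤ D → src k p ≤ s k * (A * lam ^ (p - 1) * Q ^ p))
    (hstep : ∀ k < K, ∀ N : ℕ, 2 ≤ N → ∀ p, 3 ≤ p → p ≤ D → Φ * towerV D τ (μb k) < 1 →
      db (k + 1) p ≤ towerFO D σ (dμ k) p + ∑ n ∈ Icc 2 N, exp 1 * Φ ^ (n - 1) * ψ ^ p * towerSLip D τ (dμ k) (μb k) n p +
        Ct * (ψ ^ p * exp 1 * towerV D τ (μb k) * (Φ * towerV D τ (μb k)) ^ N / (1 - Φ * towerV D τ (μb k))) + src k p)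
    (hx₁ : 4 * σ * lam * Q' < 1) (hx₂ : 2 * lam * τ * Q' ≤ 1) (hx₃ : exp 1 * τ * lam * Q' < 1)
    (hy : Φ * (τ * (ι₁ * lam + ι₂ / (2 * Q') + ι₃ / (4 * Q' ^ 2) + A' * Q' / 4)) < 1)
    (hθ : Φ * (exp 1 * τ * (ι₁ * lam) + (exp 1 * τ) ^ 2 * (ι₂ * lam) + (exp 1 * τ) ^ 3 * (ι₃ * lam ^ 2) +
      A' * (exp 1 * τ * Q') * ((exp 1 * τ * lam * Q') ^ 3 / (1 - exp 1 * τ * lam * Q'))) < 1)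
    (hu₁ : 4 * Q' ≤ Q) (hu₂ : 2 * τ * ψ * Q' ≤ Q)
    (hclose : A' * (4 * Q') ^ 3 * (4 * σ * lam * Q' / (1 - 4 * σ * lam * Q')) +
      exp 1 * ψ * (2 * τ * ψ * Q') ^ 2 * (τ * (ι₁ * lam + ι₂ / (2 * Q') + ι₃ / (4 * Q' ^ 2) + A' * Q' / 4)) *
        ((2 * (Φ * (τ * (ι₁ * lam + ι₂ / (2 * Q') + ι₃ / (4 * Q' ^ 2) + A' * Q' / 4))) -
            (Φ * (τ * (ι₁ * lam + ι₂ / (2 * Q') + ι₃ / (4 * Q' ^ 2) + A' * Q' / 4))) ^ 2) /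
          (1 - Φ * (τ * (ι₁ * lam + ι₂ / (2 * Q') + ι₃ / (4 * Q' ^ 2) + A' * Q' / 4))) ^ 2) ≤ A * Q ^ 3) :
    ∀ k ≤ K, ∀ p, 3 ≤ p → p ≤ D → db k p ≤ R k * (A * lam ^ (p - 1) * Q ^ p) := by
  have hg1' : 0 < 1 - g := sub_pos.2 hg1
  have hg₃1' : 0 < 1 - g₃ := sub_pos.2 hg₃1
  have hA'0 : 0 ≤ A' := le_trans (by positivity) hA'ge
  have hx10 : 0 ≤ 4 * σ * lam * Q' / (1 - 4 * σ * lam * Q') := div_nonneg (by positivity) (sub_nonneg.2 hx₁.le)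
  have hw : 1 ≤ (2 * τ * Q' * lam)⁻¹ := (one_le_inv₀ (by positivity)).2 (by linarith)
  have hRmono : ∀ {k' k}, k' ≤ k → R k' ≤ R k := fun h => budget_mono hs0 hR h
  have hRk0 : ∀ k, 0 ≤ R k := fun k => hR0.trans (hRmono (Nat.zero_le k))
  set Y := ι₁ * lam + ι₂ / (2 * Q') + ι₃ / (4 * Q' ^ 2) + A' * Q' / 4 with hY
  suffices H : ∀ k ≤ K, ∀ k' ≤ k, ∀ p, 3 ≤ p → p ≤ D → db k' p ≤ R k' * (A * lam ^ (p - 1) * Q ^ p) from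
    fun k hk p hp hpD => H k hk k le_rfl p hp hpD
  intro k
  induction k with
  | zero => intro _ k' hk' p hp hpD; rw [Nat.le_zero.1 hk']; exact hd0 p hp hpD
  | succ k ih =>
    intro hk1 k' hk' p hp hpD
    have hkK : k < K := Nat.lt_of_succ_le hk1
    have ih' := ih (Nat.le_of_succ_le hk1)
    rcases Nat.lt_succ_iff_lt_or_eq.1 (Nat.lt_succ_of_le hk') with hlt | rfl
    · exact ih' k' (Nat.lt_succ_iff.1 hlt) p hp hpD
    · have hD3 : 3 ≤ D := hp.trans hpD
      have hRk := hRk0 k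
      -- born differences at boundaries `k' ≤ k` are below the law with the CURRENT budget `R k`
      have hborn : ∀ k' ≤ k, ∀ m, 3 ≤ m → m ≤ D → db k' m ≤ (R k * A) * lam ^ (m - 1) * Q ^ m := by
        intro k' hk' m hm hmD
        calc db k' m ≤ R k' * (A * lam ^ (m - 1) * Q ^ m) := ih' k' hk' m hm hmD
          _ ≤ R k * (A * lam ^ (m - 1) * Q ^ m) := mul_le_mul_of_nonneg_right (hRmono hk') (by positivity)
          _ = _ := by ring
      -- degrees ≥ 8: T1 on the differences (six-leg entry zeroed)
      set μ4 : ℕ → ℕ → ℝ := fun k m => if 4 ≤ m then dμ k m else 0 with hμ4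
      have hμ4hyp : ∀ m, 3 ≤ m → m ≤ D → μ4 k m ≤ ∑ k' ∈ range (k + 1), c₁ * c₂ ^ m * g ^ ((m - 2) * (k + 1 - k')) * db k' m := by
        intro m hm3 hmD
        rw [hμ4]; dsimp only
        split_ifs with h4
        · exact hdμ k hkK m h4 hmD
        · exact sum_nonneg fun k' _ => by have := hdb0 k' m; positivity
      have hprofd : ∀ m, 4 ≤ m → m ≤ D → dμ k m ≤ (R k * A') * lam ^ (m - 1) * Q' ^ m := by
        intro m hm4 hmD
        have hT1 := towerMeasured_le_profile (D := D) (μ := μ4) (mul_nonneg hRk hA) hlam.le hQ hg0 hg1 hc₁ hc₂ hdb0 hμ4hyp hborn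
          (by omega) hmD
        rw [hμ4] at hT1; dsimp only at hT1; rw [if_pos hm4] at hT1
        refine hT1.trans ?_
        rw [show c₁ * (R k * A) / ((1 - g) * g ^ 2) = R k * (c₁ * A / ((1 - g) * g ^ 2)) by ring]
        have : 0 ≤ c₁ * A / ((1 - g) * g ^ 2) := by positivity
        have : 0 ≤ c₂ * g * Q := by positivity
        gcongr
      -- six legs
      have hdμ3' : dμ k 3 ≤ R k * ι₃ * lam ^ 2 := by
        have h := towerMeasured_three_le (mul_nonneg hRk hA) hQ hg₃0 hg₃1 hc₁ hc₂ hdb0 (hdμ3 k hkK hD3)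
          (fun k' hk' => hborn k' hk' 3 le_rfl hD3)
        refine h.trans ?_
        rw [show c₁ * c₂ ^ 3 * (R k * A) * Q ^ 3 * (g₃ / (1 - g₃)) * lam ^ 2 =
          R k * (c₁ * c₂ ^ 3 * A * Q ^ 3 * (g₃ / (1 - g₃))) * lam ^ 2 by ring]
        gcongr
      -- Chernoff data of the differences (relative four-piece profile) and of the majorant
      have hGν := sum_fourPiece_le (D := D) (ι₁ := R k * ι₁) (ι₂ := R k * ι₂) (ι₃ := R k * ι₃) (A' := R k * A') hτ hlam hQ'0
        (mul_nonneg hRk hA'0) (hdμ0 k) (hdι₁ k hkK) (hdι₂ k hkK) hdμ3' hprofd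
      have hGνeq : τ * (R k * ι₁ * lam + R k * ι₂ / (2 * Q') + R k * ι₃ / (4 * Q' ^ 2) + R k * A' * Q' / 4) = R k * (τ * Y) := by
        rw [hY]; ring
      rw [hGνeq] at hGν
      have hG := sum_fourPiece_le (D := D) hτ hlam hQ'0 hA'0 (hμb0 k) (hῑ₁ k hkK) (hῑ₂ k hkK) (hῑ₃ k hkK) (hprofb k hkK)
      have hG0 : 0 ≤ τ * Y := (sum_nonneg fun δ _ => by have := hμb0 k δ; positivity).trans hG
      have hVb := towerV_le_fourPiece hτ.le hlam.le hQ'0.le hA'0 (hμb0 k) (hῑ₁ k hkK) (hῑ₂ k hkK) (hῑ₃ k hkK) (hprofb k hkK) hx₃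
      have hFO := towerFO_le_of_four_le hσ (mul_nonneg hRk hA'0) hlam.le hQ'0.le (hdμ0 k) hprofd hx₁ hp (D := D)
      have hT2 := towerLipStep_le_of_chernoff (D := D) hΦ hψ hτ.le (hdμ0 k) (hμb0 k) hw hCt hFO hGν hG hVb hy hθ
        (fun N hN hguard => hstep k hkK N hN p hp hpD hguard)
      refine hT2.trans ?_
      have hinv : (((2 * τ * Q' * lam)⁻¹) ^ (p - 1))⁻¹ = (2 * τ * Q' * lam) ^ (p - 1) := by rw [inv_pow, inv_inv]
      rw [hinv]
      set y := Φ * (τ * Y) with hy'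
      have hy0 : 0 ≤ y := by positivity
      have hy1 : y ≤ 1 := hy.le
      have hZ0 : 0 ≤ (2 * y - y ^ 2) / (1 - y) ^ 2 := by
        refine div_nonneg ?_ (sq_nonneg _)
        rw [show 2 * y - y ^ 2 = y * (2 - y) by ring]
        exact mul_nonneg hy0 (by linarith only [hy1])
      obtain ⟨r, rfl⟩ : ∃ r, p = 3 + r := ⟨p - 3, by omega⟩
      have h4 : (4 * Q') ^ (3 + r) ≤ (4 * Q') ^ 3 * Q ^ r := by
        rw [pow_add]; exact mul_le_mul_of_nonneg_left (pow_le_pow_left₀ (by positivity) hu₁ r) (by positivity)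
      have h2 : ψ ^ (3 + r) * (2 * τ * Q' * lam) ^ (3 + r - 1) ≤ lam ^ (3 + r - 1) * ψ * ((2 * τ * ψ * Q') ^ 2 * Q ^ r) := by
        have heq : ψ ^ (3 + r) * (2 * τ * Q' * lam) ^ (3 + r - 1) = lam ^ (3 + r - 1) * ψ * ((2 * τ * ψ * Q') ^ 2 * (2 * τ * ψ * Q') ^ r) := by
          rw [show 3 + r - 1 = r + 2 by omega, show 3 + r = r + 2 + 1 by omega]
          ring
        rw [heq]
        have hr : (2 * τ * ψ * Q') ^ r ≤ Q ^ r := pow_le_pow_left₀ (by positivity) hu₂ r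
        exact mul_le_mul_of_nonneg_left (mul_le_mul_of_nonneg_left hr (by positivity)) (by positivity)
      set X₁ := 4 * σ * lam * Q' / (1 - 4 * σ * lam * Q') with hX₁
      set Z := (2 * y - y ^ 2) / (1 - y) ^ 2 with hZ
      have hsrc' := hsrc k hkK (3 + r) hp hpD
      calc R k * A' * lam ^ (3 + r - 1) * (4 * Q') ^ (3 + r) * X₁ +
            exp 1 * ψ ^ (3 + r) * (2 * τ * Q' * lam) ^ (3 + r - 1) * (R k * (τ * Y)) * Z + src k (3 + r)
          ≤ R k * A' * lam ^ (3 + r - 1) * ((4 * Q') ^ 3 * Q ^ r) * X₁ +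
            exp 1 * (lam ^ (3 + r - 1) * ψ * ((2 * τ * ψ * Q') ^ 2 * Q ^ r)) * (R k * (τ * Y)) * Z +
              s k * (A * lam ^ (3 + r - 1) * Q ^ (3 + r)) := by
            have : exp 1 * ψ ^ (3 + r) * (2 * τ * Q' * lam) ^ (3 + r - 1) = exp 1 * (ψ ^ (3 + r) * (2 * τ * Q' * lam) ^ (3 + r - 1)) := by
              ring
            rw [this]
            gcongr
        _ = R k * (lam ^ (3 + r - 1) * Q ^ r * (A' * (4 * Q') ^ 3 * X₁ + exp 1 * ψ * (2 * τ * ψ * Q') ^ 2 * (τ * Y) * Z)) +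
              s k * (A * lam ^ (3 + r - 1) * Q ^ (3 + r)) := by ring
        _ ≤ R k * (lam ^ (3 + r - 1) * Q ^ r * (A * Q ^ 3)) + s k * (A * lam ^ (3 + r - 1) * Q ^ (3 + r)) := by
            have := mul_le_mul_of_nonneg_left hclose (show 0 ≤ lam ^ (3 + r - 1) * Q ^ r by positivity)
            exact add_le_add_left (mul_le_mul_of_nonneg_left this hRk) _
        _ = (R k + s k) * (A * lam ^ (3 + r - 1) * Q ^ (3 + r)) := by rw [pow_add]; ring
        _ ≤ R (k + 1) * (A * lam ^ (3 + r - 1) * Q ^ (3 + r)) := mul_le_mul_of_nonneg_right (hR k) (by positivity)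

end Summit.HubbardSuperconductivity.HubbardSuperconductivity.Theorems.EngineV8

end
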